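import Literature.Probability.LatticeModels.ScaleFrameOuterDatumDecomp
import HarnessLib

/-!
# The probability of an outer exploration datum is comparable across environments (proved)

Topic `Literature/Probability/LatticeModels` (trunk `StatMech`, family `crit-ising`). The mirror
image of `ScaleFrameDatum.lean` (Kesten's ratio-limit scheme, H. Kesten, PTRF 73 (1986), §2, proof of
Lemma (23), run with the exploration data of D. Basu, A. Sapozhnikov, ECP 22 (2017), §2, on a
`ScaleFrame`): the block `annSet b (bM)` is explored FROM THE OUTSIDE `outSet b (bM)`; an outer datum
is a pair `(X, Y)` (explored set `X ⊇ outSet b (bM)`, rim `Y` just inside scale `b`), saturated by the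
clause "the rim is wired through open edges of `X ∖ outSet b (bM)`". Its probability must not depend,
up to the RSW constant `c`, on the environment deep inside: for every edge set `Eenv` between the edges
not below scale `b/M³` and the frame, and every wired set `Benv` of good vertices below scale `b/M⁴`,
`c · φ^∅_loc(G(X,Y)) ≤ φ^{Benv}_{⟨Eenv⟩}(G(X,Y))` and `c · φ^{Benv}_{⟨Eenv⟩}(G(X,Y)) ≤ φ^∅_loc(G(X,Y))`
(`ScaleFrame.outerDatum_prob_comparable`, registered short name `outerDatum_prob_comparable`).

Proof (tools of `ScaleFrame(Outer)DatumDecomp.lean`). (0) On lattice configurations `G = D ∩ I`, `D` the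
decreasing cylinder "the frame edges `Sc` from `X` to vertices off `X ∪ Y` are closed", `I` increasing
and read on the edges `T` from `X` into `X ∪ Y`; both live in the core `outSet (b/M²) (b/M)` (the
non-good vertices and the good ones of radius `≥ b/M`). (1) Closed-outside domain Markov:
`φ(D ∩ I) = φ(D) · φ_{∖Sc}(I)`. (2)–(3) The conditional-domination sandwich between the free measure of
the local edges and the measure wired on `L = Benv ∪ inSet (b/M³)` (which contains the endpoints of all
environment edges off the local ones), closed up by the monotone boundary-pushing toolkit (B'), (A) of
`RandomClusterBoundaryPushing.lean` across the collar `(b/M², b/M)`, fed by the frame's `NoCrossBound`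
read backwards (`ScaleFrame.real_outCross_le_of_noCrossBound`: a crossing from the core inwards is a
reversed radial crossing). (4) Multiply. Everything is proved; no definitions.

## References
* [Kesten1986] H. Kesten, Probab. Theory Related Fields 73 (1986) 369–394, §2, proof of Lemma (23).
* [BasuSapozhnikov2017ECP] D. Basu, A. Sapozhnikov, ECP 22 (2017) no. 26, §2.
* G. Grimmett, *The Random-Cluster Model*, Springer (2006): Thm. (3.1)(a), Lemma (4.13), (4.14).
-/

noncomputable section

open MeasureTheory Finset SimpleGraph
open Literature.Probability.Percolation (BondConfig openConnIn explSet explRim explEvent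
  mem_explEvent_iff subset_explSet mem_of_mem_explEvent_of_open_edge explRim_disjoint openConnIn_mono)

namespace Literature.Probability.LatticeModels

/-- **(K1-out) The probability of an outer datum is comparable across environments** (Kesten 1986,
proof of Lemma (23), for the random-cluster measure with the exploration data of Basu–Sapozhnikov
2017, §2, explored from the outside). For a scale frame with `M ≥ 4`, `bM ≤ Rmax`, `η ≤ b/M⁴` and the
no-radial-crossing bound (RSW (ii)) for the annulus `(b/M², b/M)`: for outer data
`outSet b (bM) ⊆ X ⊆ outSet b (bM) ∪ annSet b (bM)`, `Y ⊆ {good, b - η < rad ≤ b}`, the saturated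
datum event `Gd = {𝒞 = X, 𝒟 = Y} ∩ {rim wired through X ∖ outSet b (bM)}` (read on `ω ∩ E`)
satisfies `c · loc(Gd) ≤ env(Gd)` and `c · env(Gd) ≤ loc(Gd)`, where `loc` is the free measure of the
edges not below scale `b/M³` and `env` the measure of ANY edge set between those and `E`, wired on ANY
set of good vertices below scale `b/M⁴`. [cite: Kesten1986, proof of Lemma (23)] -/
theorem ScaleFrame.outerDatum_prob_comparable :
    ∀ {V : Type*} [Fintype V] [DecidableEq V] (F : ScaleFrame V) {p q c b M : ℝ},
      p ∈ Set.Ico (0 : ℝ) 1 → 1 ≤ q → 0 < c → 0 < b → 4 ≤ M → b * M ≤ F.Rmax → F.η ≤ b / M ^ 4 →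
      F.NoCrossBound p q c (b / M ^ 2) (b / M) →
    ∀ (X Y : Set V),
      F.outSet b (b * M) ⊆ X → X ⊆ F.outSet b (b * M) ∪ F.annSet b (b * M) →
      (∀ v ∈ Y, v ∈ F.good ∧ b - F.η < F.rad v ∧ F.rad v ≤ b) →
    ∀ (Eenv : Finset (Sym2 V)) (Benv : Set V),
      F.E \ F.edgesWithin (F.inSet (b / M ^ 3)) ⊆ Eenv → Eenv ⊆ F.E →
      (∀ v ∈ Benv, v ∈ F.good ∧ F.rad v ≤ b / M ^ 4) →
      let Gd : Set (BondConfig V) := {ω | ω ∩ (↑F.E : Set (Sym2 V)) ∈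
        explEvent (F.outSet b (b * M)) (F.annSet b (b * M)) X Y ∩
          {ω | ∀ r ∈ Y, ∀ r₂ ∈ Y, ∃ v ∈ X \ F.outSet b (b * M), ∃ v' ∈ X \ F.outSet b (b * M),
            s(v, r) ∈ ω ∧ s(v', r₂) ∈ ω ∧ ω ∈ openConnIn (X \ F.outSet b (b * M)) v v'}}
      let loc := rcMeasure (fromEdgeSet (↑(F.E \ F.edgesWithin (F.inSet (b / M ^ 3))) : Set (Sym2 V))) p q ∅
      let env := rcMeasure (fromEdgeSet (↑Eenv : Set (Sym2 V))) p q Benv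
      c * loc.real Gd ≤ env.real Gd ∧ c * env.real Gd ≤ loc.real Gd := by
  intro V _ _ F p q c b M hp hq hc hb hM hRmax hη hNC X Y hInX hXIB hY Eenv Benv hEenv hEenvE hBenv
    Gd loc env
  classical
  have hp' : p ∈ Set.Icc (0 : ℝ) 1 := ⟨hp.1, hp.2.le⟩
  have hq0 : 0 < q := one_pos.trans_le hq
  -- the scales
  obtain ⟨hF1, hF2, hF3, hF4, hF10, hF6, hF7⟩ := outer_scale_facts (η := F.η) hb (by linarith) hη
  have hF9 : b / M ≤ F.Rmax := by linarith
  -- the objects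
  set In : Set V := F.outSet b (b * M) with hIn_def
  set Blk : Set V := F.annSet b (b * M) with hBlk_def
  set Core : Set V := F.outSet (b / M ^ 2) (b / M) with hCore_def
  set Ann : Set V := F.annSet (b / M ^ 2) (b / M) with hAnn_def
  set E₄ : Finset (Sym2 V) := F.E \ F.edgesWithin (F.inSet (b / M ^ 3)) with hE₄_def
  set L : Set V := Benv ∪ F.inSet (b / M ^ 3) with hL_def
  set Sc : Finset (Sym2 V) := F.E.filter (fun e => ∃ v ∈ e, ∃ w ∈ e, v ∈ X ∧ w ∉ X ∪ Y)
    with hSc_def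
  set T : Finset (Sym2 V) :=
    F.E.filter (fun e => ¬ e.IsDiag ∧ (∃ v ∈ e, v ∈ X) ∧ ∀ x ∈ e, x ∈ X ∪ Y) with hT_def
  set R₂ : Finset (Sym2 V) := E₄.filter (fun e => ¬ e.IsDiag) with hR₂_def
  set EL : Finset (Sym2 V) := R₂ \ Sc with hEL_def
  set EE : Finset (Sym2 V) := (Eenv.filter fun e => ¬ e.IsDiag) \ Sc with hEE_def
  set EA : Finset (Sym2 V) := (F.edgesTouching Ann).filter (fun e => ¬ e.IsDiag) with hEA_def
  set D : Set (BondConfig V) := {ω | ∀ e ∈ Sc, e ∉ ω} with hD_def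
  set P : Set (Sym2 V) → Prop := fun Z => (∀ v ∈ X, ∃ u ∈ In, Z ∈ openConnIn X u v) ∧
      ∀ r ∈ Y, ∀ r₂ ∈ Y, ∃ v ∈ X \ In, ∃ v' ∈ X \ In,
        s(v, r) ∈ Z ∧ s(v', r₂) ∈ Z ∧ Z ∈ openConnIn (X \ In) v v'
    with hP_def
  set I : Set (BondConfig V) := {ω | P (ω ∩ ↑T)} with hI_def
  -- the regions: the outside `In`, the core, and where `X`, `Y` and their neighbours live
  have hIn_rad : ∀ v ∈ In, v ∈ F.good → b * M ≤ F.rad v := fun v hv =>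
    (F.mem_outSet_iff_of_lt hF7).1 hv
  have hnotIn : ∀ v : V, v ∉ In → v ∈ F.good ∧ F.rad v < b * M := fun v hv => by
    rw [F.mem_outSet_iff_of_lt hF7, Classical.not_imp, not_le] at hv
    exact hv
  have hCore_of : ∀ v : V, (v ∈ F.good → b / M ≤ F.rad v) → v ∈ Core := fun v hv =>
    (F.mem_outSet_iff_of_lt hF10).2 hv
  have hCore_rad : ∀ v ∈ Core, v ∈ F.good → b / M ≤ F.rad v := fun v hv =>
    (F.mem_outSet_iff_of_lt hF10).1 hv
  have hCA : ∀ v ∈ Core, v ∉ Ann := fun v hv hvA => F.mem_outSet.1 hv (Or.inr hvA)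
  have hInCore : In ⊆ Core := fun v hv => hCore_of v fun hvg => by
    have := hIn_rad v hv hvg; linarith
  have hXrad : ∀ v ∈ X, v ∈ F.good → b < F.rad v := fun v hv hvg => by
    rcases hXIB hv with hvI | ⟨-, hvb, -⟩
    · have := hIn_rad v hvI hvg; linarith
    · exact hvb
  have hXCore : X ⊆ Core := fun v hv => hCore_of v fun hvg => by
    have := hXrad v hv hvg; linarith
  have hYCore : ∀ r ∈ Y, r ∈ Core := fun r hr => hCore_of r fun _ => by
    have := (hY r hr).2.1; linarith
  have hYIB : ∀ r ∈ Y, r ∉ In ∪ Blk := fun r hr h => by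
    obtain ⟨hrg, -, hrb⟩ := hY r hr
    rcases h with hrI | ⟨-, hbr, -⟩
    · have := hIn_rad r hrI hrg; linarith
    · linarith
  have hXin : ∀ v ∈ X, v ∉ F.inSet (b / M ^ 3) := fun v hv ⟨hvg, hvr⟩ => by
    have := hXrad v hv hvg; linarith
  have hnearCore : ∀ e ∈ F.E, ∀ v ∈ e, v ∈ X → ∀ x ∈ e, x ∈ Core := by
    intro e he v hv hvX x hx
    by_cases hxI : x ∈ In
    · exact hInCore hxI
    · obtain ⟨hxg, hxR⟩ := hnotIn x hxI
      obtain ⟨hvg, hvr⟩ := F.adj_good e he x hx v hv hxg (by linarith)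
      have h1 := hXrad v hvX hvg
      have h2 := (abs_lt.1 hvr).2
      exact hCore_of x fun _ => by linarith
  -- the edge sets
  have hSc_mem : ∀ e, e ∈ Sc ↔ e ∈ F.E ∧ ∃ v ∈ e, ∃ w ∈ e, v ∈ X ∧ w ∉ X ∪ Y := fun e => by
    rw [hSc_def, Finset.mem_filter]
  have hT_mem : ∀ e, e ∈ T ↔ e ∈ F.E ∧ ¬ e.IsDiag ∧ (∃ v ∈ e, v ∈ X) ∧ ∀ x ∈ e, x ∈ X ∪ Y :=
    fun e => by rw [hT_def, Finset.mem_filter]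
  have hE₄F : E₄ ⊆ F.E := Finset.sdiff_subset
  have hE₄_of : ∀ e ∈ F.E, ∀ x ∈ e, x ∉ F.inSet (b / M ^ 3) → e ∈ E₄ := fun e he x hx hxn =>
    Finset.mem_sdiff.2 ⟨he, fun heW => hxn ((F.mem_edgesWithin.1 heW).2 x hx)⟩
  have hnotE₄ : ∀ e ∈ F.E, e ∉ E₄ → ∀ x ∈ e, x ∈ F.inSet (b / M ^ 3) := fun e he heE x hx => by
    by_contra hxn
    exact heE (hE₄_of e he x hx hxn)
  have hR₂_mem : ∀ e, e ∈ R₂ ↔ e ∈ E₄ ∧ ¬ e.IsDiag := fun e => by rw [hR₂_def, Finset.mem_filter]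
  have hEL_mem : ∀ e, e ∈ EL ↔ (e ∈ E₄ ∧ ¬ e.IsDiag) ∧ e ∉ Sc := fun e => by
    rw [hEL_def, Finset.mem_sdiff, hR₂_mem]
  have hEE_mem : ∀ e, e ∈ EE ↔ (e ∈ Eenv ∧ ¬ e.IsDiag) ∧ e ∉ Sc := fun e => by
    rw [hEE_def, Finset.mem_sdiff, Finset.mem_filter]
  have hEA_mem : ∀ e, e ∈ EA ↔ (e ∈ F.E ∧ ∃ v ∈ e, v ∈ Ann) ∧ ¬ e.IsDiag := fun e => by
    rw [hEA_def, Finset.mem_filter, F.mem_edgesTouching]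
  have hScE₄ : Sc ⊆ E₄ := fun e he => by
    obtain ⟨heE, v, hv, w, -, hvU, -⟩ := (hSc_mem e).1 he
    exact hE₄_of e heE v hv (hXin v hvU)
  have hScR₂ : Sc ⊆ R₂ := fun e he => by
    obtain ⟨-, v, hv, w, hw, hvU, hwUR⟩ := (hSc_mem e).1 he
    have hne : v ≠ w := fun h => hwUR (Or.inl (h ▸ hvU))
    refine (hR₂_mem e).2 ⟨hScE₄ he, ?_⟩
    rw [(Sym2.mem_and_mem_iff hne).1 ⟨hv, hw⟩, Sym2.mk_isDiag_iff]
    exact hne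
  have hScCore : ∀ e ∈ Sc, ∀ x ∈ e, x ∈ Core := fun e he x hx => by
    obtain ⟨heE, v, hv, w, -, hvU, -⟩ := (hSc_mem e).1 he
    exact hnearCore e heE v hv hvU x hx
  have hTE₄ : T ⊆ E₄ := fun e he => by
    obtain ⟨heE, -, ⟨v, hv, hvX⟩, -⟩ := (hT_mem e).1 he
    exact hE₄_of e heE v hv (hXin v hvX)
  have hTSc : ∀ e ∈ T, e ∉ Sc := fun e he heS => by
    obtain ⟨-, -, -, hall⟩ := (hT_mem e).1 he
    obtain ⟨-, v, -, w, hw, -, hwUR⟩ := (hSc_mem e).1 heS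
    exact hwUR (hall w hw)
  have hTEL : T ⊆ EL := fun e he => (hEL_mem e).2 ⟨⟨hTE₄ he, ((hT_mem e).1 he).2.1⟩, hTSc e he⟩
  have hTEE : T ⊆ EE := fun e he =>
    (hEE_mem e).2 ⟨⟨hEenv (hTE₄ he), ((hT_mem e).1 he).2.1⟩, hTSc e he⟩
  have hTCore : ∀ e ∈ T, ∀ x ∈ e, x ∈ Core := fun e he x hx => by
    obtain ⟨-, -, -, hall⟩ := (hT_mem e).1 he
    rcases hall x hx with hxX | hxY
    · exact hXCore hxX
    · exact hYCore x hxY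
  have hELF : EL ⊆ F.E := fun e he => hE₄F ((hEL_mem e).1 he).1.1
  have hR₂F : R₂ ⊆ F.E := fun e he => hE₄F ((hR₂_mem e).1 he).1
  -- the collar hypotheses of the boundary-pushing toolkit
  have hCoreE : ∀ E' : Finset (Sym2 V), E' ⊆ F.E → ∀ e ∈ E', (∃ v ∈ Core, v ∈ e) →
      ∀ x ∈ e, x ∈ Core ∨ x ∈ Ann := fun E' hE' e he ⟨v, hv, hve⟩ x hx => by
    by_contra hno
    rw [not_or] at hno
    have hxC : x ∈ F.inSet (b / M ^ 2) ∪ Ann := by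
      have h := hno.1
      rw [hCore_def, ScaleFrame.mem_outSet, not_not] at h
      exact h
    rcases F.mem_inSet_or_annSet_of_adj hF1 hF9 (hE' he) hx hve (hxC.resolve_right hno.2) with
      hvI | hvA
    · rw [hCore_def, ScaleFrame.mem_outSet] at hv
      exact hv (Or.inl hvI)
    · exact hCA v hv hvA
  have hW : ∀ w ∈ L, w ∉ Core ∧ w ∉ Ann := by
    intro w hw
    have hw' : w ∈ F.good ∧ F.rad w ≤ b / M ^ 3 := by
      rcases hw with hwB | ⟨hwg, hwr⟩
      · exact ⟨(hBenv w hwB).1, (hBenv w hwB).2.trans hF3⟩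
      · exact ⟨hwg, hwr⟩
    refine ⟨fun hwC => ?_, fun ⟨_, hwA, _⟩ => ?_⟩
    · have := hCore_rad w hwC hw'.1; linarith
    · linarith
  have hAnnE₄ : ∀ e ∈ F.E, (∃ v ∈ e, v ∈ Ann) → e ∈ E₄ := fun e he ⟨v, hv, _, hvA, _⟩ =>
    hE₄_of e he v hv fun ⟨_, hvr⟩ => by linarith
  have hEA_R₂ : ∀ e, e ∈ EA ↔ e ∈ R₂ ∧ ∃ v ∈ Ann, v ∈ e := fun e => by
    rw [hEA_mem, hR₂_mem]
    constructor
    · rintro ⟨⟨heE, v, hv, hvA⟩, hnd⟩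
      exact ⟨⟨hAnnE₄ e heE ⟨v, hv, hvA⟩, hnd⟩, v, hvA, hv⟩
    · rintro ⟨⟨heE₄, hnd⟩, v, hvA, hv⟩
      exact ⟨⟨hE₄F heE₄, v, hv, hvA⟩, hnd⟩
  have hEA_EL : ∀ e, e ∈ EA ↔ e ∈ EL ∧ ∃ v ∈ Ann, v ∈ e := fun e => by
    rw [hEA_R₂, hEL_mem, hR₂_mem]
    constructor
    · rintro ⟨h, v, hvA, hv⟩
      exact ⟨⟨h, fun heS => hCA v (hScCore e heS v hv) hvA⟩, v, hvA, hv⟩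
    · rintro ⟨⟨h, -⟩, hv⟩
      exact ⟨h, hv⟩
  -- (0) the datum event on lattice configurations: closed cylinder `D` and increasing part `P`
  have hdec : ∀ ω : BondConfig V, (∀ e ∈ ω, e ∈ F.E ∧ ¬ e.IsDiag) →
      (ω ∈ Gd ↔ (∀ e ∈ Sc, e ∉ ω) ∧ P (ω ∩ ↑T)) := by
    intro ω hω
    have hωE : ω ∩ (↑F.E : Set (Sym2 V)) = ω :=
      Set.inter_eq_left.2 fun e he => Finset.mem_coe.2 (hω e he).1
    show ω ∩ (↑F.E : Set (Sym2 V)) ∈ explEvent In Blk X Y ∩ _ ↔ _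
    rw [hωE]
    refine mem_explEvent_rimWiredOff_iff hInX hXIB hYIB
      (fun e he => ((hSc_mem e).1 (Finset.mem_coe.1 he)).2)
      (fun v hv w hw h => Finset.mem_coe.2 ((hSc_mem _).2
        ⟨(hω _ h).1, v, Sym2.mem_mk_left v w, w, Sym2.mem_mk_right v w, hv, hw⟩))
      fun v hv w hw hne h => Finset.mem_coe.2 ((hT_mem _).2
        ⟨(hω _ h).1, (hω _ h).2, ⟨v, Sym2.mem_mk_left v w, hv⟩, fun x hx => ?_⟩)
    rcases Sym2.mem_iff.1 hx with rfl | rfl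
    · exact Or.inl hv
    · exact hw
  have hAE : ∀ E' : Finset (Sym2 V), E' ⊆ F.E → ∀ ω : BondConfig V,
      ω ⊆ (fromEdgeSet (E' : Set (Sym2 V))).edgeSet →
        (ω ∈ Gd ↔ (∀ e ∈ Sc, e ∉ ω) ∧ P (ω ∩ ↑T)) :=
    fun E' hE' ω hω => hdec ω fun e he => by
      have h := hω he
      rw [edgeSet_fromEdgeSet, Set.mem_sdiff, Finset.mem_coe, Sym2.mem_diagSet] at h
      exact ⟨hE' h.1, h.2⟩
  -- monotonicity and locality of `D` and `I`
  have hPmono : ∀ Z Z' : Set (Sym2 V), Z ⊆ Z' → P Z → P Z' := by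
    rintro Z Z' hZZ' ⟨h1, h2⟩
    refine ⟨fun v hv => ?_, fun r hr r₂ hr₂ => ?_⟩
    · obtain ⟨u, hu, huv⟩ := h1 v hv
      exact ⟨u, hu, openConnIn_of_agree_ne huv fun x _ y _ _ hxy => hZZ' hxy⟩
    · obtain ⟨v, hv, v', hv', hvr, hv'r, hvv'⟩ := h2 r hr r₂ hr₂
      exact ⟨v, hv, v', hv', hZZ' hvr, hZZ' hv'r,
        openConnIn_of_agree_ne hvv' fun x _ y _ _ hxy => hZZ' hxy⟩
  have hI : IsUpperSet I := fun ω₁ ω₂ hle h =>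
    hPmono _ _ (Set.inter_subset_inter_left _ hle) h
  have hD : IsLowerSet D := fun ω₁ ω₂ hle h e he heω => h e he (hle heω)
  have hDdet : ∀ ω₁ ω₂ : BondConfig V, (∀ e ∈ R₂, (∀ x ∈ e, x ∈ Core) → (e ∈ ω₁ ↔ e ∈ ω₂)) →
      (ω₁ ∈ D ↔ ω₂ ∈ D) := fun ω₁ ω₂ h =>
    forall₂_congr fun e he => not_congr (h e (hScR₂ he) (hScCore e he))
  have hIdet : ∀ ω₁ ω₂ : BondConfig V, (∀ e ∈ EL, (∀ x ∈ e, x ∈ Core) → (e ∈ ω₁ ↔ e ∈ ω₂)) →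
      (ω₁ ∈ I ↔ ω₂ ∈ I) := fun ω₁ ω₂ h => by
    have hTeq : ω₁ ∩ (↑T : Set (Sym2 V)) = ω₂ ∩ ↑T := Set.ext fun e => by
      refine ⟨fun he => ⟨?_, he.2⟩, fun he => ⟨?_, he.2⟩⟩
      · exact (h e (hTEL (Finset.mem_coe.1 he.2)) (hTCore e (Finset.mem_coe.1 he.2))).1 he.1
      · exact (h e (hTEL (Finset.mem_coe.1 he.2)) (hTCore e (Finset.mem_coe.1 he.2))).2 he.1
    show P (ω₁ ∩ ↑T) ↔ P (ω₂ ∩ ↑T)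
    rw [hTeq]
  have hDR₂ : {ω : BondConfig V | ω ∩ ↑R₂ ∈ D} = D := Set.ext fun ω =>
    forall₂_congr fun e he => not_congr ⟨fun h' => h'.1, fun h' => ⟨h', Finset.mem_coe.2 (hScR₂ he)⟩⟩
  have hIEL : {ω : BondConfig V | ω ∩ ↑EL ∈ I} = I := Set.ext fun ω => by
    show P (ω ∩ ↑EL ∩ ↑T) ↔ P (ω ∩ ↑T)
    rw [Set.inter_assoc, Set.inter_eq_right.2 (Finset.coe_subset.2 hTEL)]
  -- the regions inside the environment graphs, and the frozen edges off them (deep inside)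
  have hR₂env : ∀ i : Fintype (fromEdgeSet (Eenv : Set (Sym2 V))).edgeSet,
      R₂ ⊆ @edgeFinset V (fromEdgeSet (Eenv : Set (Sym2 V))) i := fun i e he =>
    (mem_edgeFinset_fromEdgeSet_iff Eenv i e).2 ⟨hEenv ((hR₂_mem e).1 he).1, ((hR₂_mem e).1 he).2⟩
  have hELEE : ∀ i : Fintype (fromEdgeSet (EE : Set (Sym2 V))).edgeSet,
      EL ⊆ @edgeFinset V (fromEdgeSet (EE : Set (Sym2 V))) i := fun i e he => by
    obtain ⟨⟨heE₄, hnd⟩, heS⟩ := (hEL_mem e).1 he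
    exact (mem_edgeFinset_fromEdgeSet_iff EE i e).2 ⟨(hEE_mem e).2 ⟨⟨hEenv heE₄, hnd⟩, heS⟩, hnd⟩
  have hLfar : ∀ e ∈ F.E, e ∉ E₄ → ∀ x ∈ e, x ∈ L := fun e he heE x hx =>
    Or.inr (hnotE₄ e he heE x hx)
  have hoffenv : ∀ i : Fintype (fromEdgeSet (Eenv : Set (Sym2 V))).edgeSet,
      ∀ e ∈ @edgeFinset V (fromEdgeSet (Eenv : Set (Sym2 V))) i \ R₂, ∀ x ∈ e, x ∈ L :=
    fun i e he x hx => by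
      obtain ⟨heG, heR⟩ := Finset.mem_sdiff.1 he
      obtain ⟨heE, hnd⟩ := (mem_edgeFinset_fromEdgeSet_iff Eenv i e).1 heG
      exact hLfar e (hEenvE heE) (fun heE₄ => heR ((hR₂_mem e).2 ⟨heE₄, hnd⟩)) x hx
  have hoffEE : ∀ i : Fintype (fromEdgeSet (EE : Set (Sym2 V))).edgeSet,
      ∀ e ∈ @edgeFinset V (fromEdgeSet (EE : Set (Sym2 V))) i \ EL, ∀ x ∈ e, x ∈ L :=
    fun i e he x hx => by
      obtain ⟨heG, heL⟩ := Finset.mem_sdiff.1 he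
      obtain ⟨heE, hnd⟩ := (mem_edgeFinset_fromEdgeSet_iff EE i e).1 heG
      obtain ⟨⟨heEnv, -⟩, heS⟩ := (hEE_mem e).1 heE
      exact hLfar e (hEenvE heEnv)
        (fun heE₄ => heL ((hEL_mem e).2 ⟨⟨heE₄, hnd⟩, heS⟩)) x hx
  have hGR : fromEdgeSet (R₂ : Set (Sym2 V)) = fromEdgeSet (E₄ : Set (Sym2 V)) := by
    rw [hR₂_def]; exact fromEdgeSet_coe_filter_not_isDiag E₄
  have hBL : Benv ⊆ L := Set.subset_union_left
  -- (2) the closed cylinder: `c · loc(D) ≤ φ^L_loc(D) ≤ env(D) ≤ φ^Benv_loc(D) ≤ loc(D)`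
  have hBpr := rcMeasure_real_free_le_wired_of_radialBound hp hq R₂ EA Core Ann L hCA hW
    (hCoreE R₂ hR₂F) hEA_R₂ hc (F.real_outCross_le_of_noCrossBound hp' hq0 hNC hR₂F) hD hDdet
  rw [rcMeasure_congr_graph hGR p q ∅] at hBpr
  have ha1 := rcMeasure_real_wired_le_region_of_isLowerSet (fromEdgeSet (Eenv : Set (Sym2 V))) hp'
    hq hBL R₂ (hR₂env _) (hoffenv _) hD
  rw [hDR₂] at ha1
  have ha : c * loc.real D ≤ env.real D := hBpr.trans ha1
  have hb : env.real D ≤ loc.real D := by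
    have h := rcMeasure_real_le_fromEdgeSet_of_isLowerSet (fromEdgeSet (Eenv : Set (Sym2 V))) hp' hq
      Benv R₂ (hR₂env _) (rcMeasure_real_cylinder_empty_pos _ hp' hp.2 hq0 Benv R₂) hD
    rw [hDR₂] at h
    calc env.real D ≤ _ := h
      _ ≤ (rcMeasure (fromEdgeSet (R₂ : Set (Sym2 V))) p q ∅).real D :=
          rcMeasure_real_anti_wired_of_isLowerSet _ hp' hq (Set.empty_subset Benv) hD
      _ = loc.real D := by rw [rcMeasure_congr_graph hGR p q ∅]
  -- (3) the increasing part on the graphs with `Sc` deleted: `locI(I) ≤ envI(I) ≤ c⁻¹ locI(I)`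
  have hc1 : (rcMeasure (fromEdgeSet (EL : Set (Sym2 V))) p q ∅).real I ≤
      (rcMeasure (fromEdgeSet (EE : Set (Sym2 V))) p q Benv).real I := by
    have h := rcMeasure_fromEdgeSet_real_le (fromEdgeSet (EE : Set (Sym2 V))) hp' hq Benv EL
      (hELEE _) (rcMeasure_real_cylinder_empty_pos _ hp' hp.2 hq0 Benv EL) hI
    rw [hIEL] at h
    exact (rcMeasure_real_mono_wired_of_isUpperSet _ hp' hq (Set.empty_subset Benv) hI).trans h
  have hApr := rcMeasure_real_wired_le_free_of_radialBound hp hq EL EA Core Ann L hCA hW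
    (hCoreE EL hELF) hEA_EL hc (F.real_outCross_le_of_noCrossBound hp' hq0 hNC hELF) hI hIdet
  have hd1 := rcMeasure_real_region_le_wired_of_isUpperSet (fromEdgeSet (EE : Set (Sym2 V))) hp'
    hq hBL EL (hELEE _) (hoffEE _) hI
  rw [hIEL] at hd1
  have hd : c * (rcMeasure (fromEdgeSet (EE : Set (Sym2 V))) p q Benv).real I ≤
      (rcMeasure (fromEdgeSet (EL : Set (Sym2 V))) p q ∅).real I :=
    (mul_le_mul_of_nonneg_left hd1 hc.le).trans hApr
  -- (1)+(4) factorise at the closed cylinder and multiply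
  have hfl : loc.real Gd = loc.real D * (rcMeasure (fromEdgeSet (EL : Set (Sym2 V))) p q ∅).real I :=
    rcMeasure_real_eq_mul_of_closed_inter hp' hq0 E₄ Sc T EL ∅ hEL_mem hTEL P (hAE E₄ hE₄F)
  have hfe : env.real Gd =
      env.real D * (rcMeasure (fromEdgeSet (EE : Set (Sym2 V))) p q Benv).real I :=
    rcMeasure_real_eq_mul_of_closed_inter hp' hq0 Eenv Sc T EE Benv hEE_mem hTEE P (hAE Eenv hEenvE)
  constructor
  · calc c * loc.real Gd
        = c * loc.real D * (rcMeasure (fromEdgeSet (EL : Set (Sym2 V))) p q ∅).real I := by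
          rw [hfl]; ring
      _ ≤ env.real D * (rcMeasure (fromEdgeSet (EE : Set (Sym2 V))) p q Benv).real I :=
          mul_le_mul ha hc1 measureReal_nonneg measureReal_nonneg
      _ = env.real Gd := hfe.symm
  · calc c * env.real Gd
        = env.real D * (c * (rcMeasure (fromEdgeSet (EE : Set (Sym2 V))) p q Benv).real I) := by
          rw [hfe]; ring
      _ ≤ loc.real D * (rcMeasure (fromEdgeSet (EL : Set (Sym2 V))) p q ∅).real I :=
          mul_le_mul hb hd (mul_nonneg hc.le measureReal_nonneg) measureReal_nonneg
      _ = loc.real Gd := hfl.symm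

/-- **(K1-out), registered short name** of `ScaleFrame.outerDatum_prob_comparable` (statement verbatim
as registered on the crux item). [cite: Kesten1986, proof of Lemma (23)] -/
theorem outerDatum_prob_comparable : ∀ {V : Type*} [Fintype V] [DecidableEq V] (F : ScaleFrame V) {p q c b M : ℝ}, p ∈ Set.Ico (0 : ℝ) 1 → 1 ≤ q → 0 < c → 0 < b → 4 ≤ M → b * M ≤ F.Rmax → F.η ≤ b / M ^ 4 → F.NoCrossBound p q c (b / M ^ 2) (b / M) → ∀ (X Y : Set V), F.outSet b (b * M) ⊆ X → X ⊆ F.outSet b (b * M) ∪ F.annSet b (b * M) → (∀ v ∈ Y, v ∈ F.good ∧ b - F.η < F.rad v ∧ F.rad v ≤ b) → ∀ (Eenv : Finset (Sym2 V)) (Benv : Set V), F.E \ F.edgesWithin (F.inSet (b / M ^ 3)) ⊆ Eenv → Eenv ⊆ F.E → (∀ v ∈ Benv, v ∈ F.good ∧ F.rad v ≤ b / M ^ 4) → let Gd : Set (BondConfig V) := {ω | ω ∩ (↑F.E : Set (Sym2 V)) ∈ explEvent (F.outSet b (b * M)) (F.annSet b (b * M)) X Y ∩ {ω | ∀ r ∈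 Y, ∀ r₂ ∈ Y, ∃ v ∈ X \ F.outSet b (b * M), ∃ v' ∈ X \ F.outSet b (b * M), s(v, r) ∈ ω ∧ s(v', r₂) ∈ ω ∧ ω ∈ openConnIn (X \ F.outSet b (b * M)) v v'}}; let loc := rcMeasure (fromEdgeSet (↑(F.E \ F.edgesWithin (F.inSet (b / M ^ 3))) : Set (Sym2 V))) p q ∅; let env := rcMeasure (fromEdgeSet (↑Eenv : Set (Sym2 V))) p q Benv; c * loc.real Gd ≤ env.real Gd ∧ c * env.real Gd ≤ loc.real Gd :=
  ScaleFrame.outerDatum_prob_comparable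

end Literature.Probability.LatticeModels

end
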